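import Summits.CriticalPhenomena.SAWScalingLimit.Theorems.SAWLeftRightFKGLeftRightFKGNotchedBoxWalk
import Summits.CriticalPhenomena.SAWScalingLimit.Theorems.SAWLeftRightFKGLeftRightFKGNotchThreePoint
import Summits.CriticalPhenomena.SAWScalingLimit.Theorems.SAWLeftRightFKGLeftRightFKGNotchUpClosed
import HarnessLib

/-!
# The crux `LeftRightFKG` ⇒ the two-chain three-point inequality at every bottom notch of every box (lead c4 glue)

Crux `stmt-CriticalPhenomena-11232`, line `corner-localisation`. Converse direction of the line's reduction, third family
(after the leaf three-point `…BoxLeafThreePoint` and the corner minor `…BoxCornerMinor` on plain boxes): on the NOTCHED box —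
the open box of sites minus the bottom-row site `s = (x_s, y₀+1)`, realised as a crux domain `dom C 1` by the rectangle walk with a
unit spur (`Families.stub_notchedBoxWalk`) — with the DIAGONAL marked pair `a = (x_s-1, y₀+1)`, `b = (x_s, y₀+2)` (`a' = (x_s-1, y₀)` on
the wall, `b' = s` the spur tip), the crux's inequality for the up-closed events `{first step West}`, `{last step not from v}`
(`Families.stub_notchUpClosed`) reads, through the class dictionary (`Families.stub_notchThreePointOfIneq`),
`Z_G(W,v)·(Z_G(v,E_b) + Z_G(v,N_b)) ≤ Z_G(W,E_b) + Z_G(W,N_b)` for the critical kernel of the free graph `G` (`box ∖ {s}` with `a, b`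
isolated), `v = (x_s-1, y₀+2)`, `W = (x_s-2, y₀+1)`, `E_b = (x_s+1, y₀+2)`, `N_b = (x_s, y₀+3)`: a GENUINE (undiscounted) three-point
inequality at the two-chain vertex `v`, on every notched box. This is the family on which x_c-sharpness of left–right association itself
rests (in the dense phase its two sides scale like `e^{2fA}` vs `e^{fA}`). Elementary given the landed stubs ("folklore").
-/

noncomputable section

open MeasureTheory
open Literature.Probability.LatticeModels Literature.Probability.RandomPlanarGeometry
open Summit.CriticalPhenomena.SAWScalingLimit.Theorems.LeftRightFKG.Negative (bx pathCross wcross)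
open Summit.CriticalPhenomena.SAWScalingLimit.Theorems.LeftRightFKG.CornerLoc
open Summit.CriticalPhenomena.SAWScalingLimit.Theorems.BoundaryTP2 (pathKernel pathKernelOn)
open scoped Classical ENNReal

namespace Summit.CriticalPhenomena.SAWScalingLimit.Theorems.LeftRightFKG.Families

/-- **The crux ⇒ the two-chain three-point inequality at `x_c` on every notched box.** For walls with `x₀ + 2 < x_s`,
`x_s + 1 < x₁`, `y₀ + 3 < y₁` there is a closed lattice walk realising the notched box `box ∖ {(x_s, y₀+1)}` as `dom C 1`, and
`LeftRightFKG` forces `Z_G(W,v)·(Z_G(v,E_b) + Z_G(v,N_b)) ≤ Z_G(W,E_b) + Z_G(W,N_b)` for the critical self-avoiding path kernel of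
its free graph `G` (marked diagonal pair `a = (x_s-1,y₀+1)`, `b = (x_s,y₀+2)` isolated). [folklore] -/
theorem notchThreePoint : Summit.CriticalPhenomena.SAWScalingLimit.Theses.SAWLeftRightFKG.LeftRightFKG →
    ∀ (x₀ x₁ y₀ y₁ x_s : ℤ), x₀ + 2 < x_s → x_s + 1 < x₁ → y₀ + 3 < y₁ →
    ∃ C : (zdGraph 2).Walk (bx x₀ y₀) (bx x₀ y₀),
      meshDomain (dom C 1) 1 = Negative.Rect.box x₀ x₁ y₀ y₁ \ {bx x_s (y₀ + 1)} ∧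
      ∀ G : SimpleGraph (Site 2),
        G = freeGraph (dom C 1) 1 0 (fun _ => bx (x_s - 1) (y₀ + 1)) 0 (fun _ => bx x_s (y₀ + 2)) →
        pathKernel G SAW.criticalFugacity (bx (x_s - 2) (y₀ + 1)) (bx (x_s - 1) (y₀ + 2)) *
            (pathKernel G SAW.criticalFugacity (bx (x_s - 1) (y₀ + 2)) (bx (x_s + 1) (y₀ + 2)) +
              pathKernel G SAW.criticalFugacity (bx (x_s - 1) (y₀ + 2)) (bx x_s (y₀ + 3))) ≤
          pathKernel G SAW.criticalFugacity (bx (x_s - 2) (y₀ + 1)) (bx (x_s + 1) (y₀ + 2)) +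
            pathKernel G SAW.criticalFugacity (bx (x_s - 2) (y₀ + 1)) (bx x_s (y₀ + 3)) := by
  intro hLR x₀ x₁ y₀ y₁ x_s h₁ h₂ h₃
  obtain ⟨C, ha', hs, hdom, hadj⟩ := stub_notchedBoxWalk x₀ x₁ y₀ y₁ x_s (by omega) (by omega) (by omega)
  refine ⟨C, hdom, fun G hG => ?_⟩
  obtain ⟨hE, hF⟩ := stub_notchUpClosed x₀ x₁ y₀ y₁ x_s C h₁ h₂ h₃ hadj
  have key := hLR 1 (bx x₀ y₀) (bx (x_s - 1) (y₀ + 1)) (bx x_s (y₀ + 2)) (bx (x_s - 1) y₀) (bx x_s (y₀ + 1)) C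
    one_pos ha' hs (Negative.adj_bx _ _ _ _ (by omega)) (Negative.adj_bx _ _ _ _ (by omega)) _ _ hE hF
  rw [weight_eq_μx] at key
  exact stub_notchThreePointOfIneq SAW.criticalFugacity x₀ x₁ y₀ y₁ x_s C SAW.criticalFugacity_pos_lt_one'.1 h₁ h₂ h₃
    hadj key G hG

end Summit.CriticalPhenomena.SAWScalingLimit.Theorems.LeftRightFKG.Families

end
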